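import Mathlib.Analysis.SpecialFunctions.Trigonometric.Complex
import Mathlib.Logic.Denumerable
import Mathlib.Data.Int.Interval
import Mathlib.SetTheory.Cardinal.Basic
import Literature.NumberTheory.LFunctions.RiemannSiegel
import Literature.NumberTheory.LFunctions.RiemannSiegelFacts
import Literature.NumberTheory.LFunctions.RiemannSiegelThetaBounds
import Literature.NumberTheory.LFunctions.TuringMethod
import Literature.Barriers.RiemannHypothesis.GramRosserFailuresProofs
import HarnessLib

/-!
# The França–LeClair base configuration: enumeration and log-sparsity (`stub_base`)

Stub `stub_base` of the line `defect-compactness-design` for the crux `WindowTraceArch`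
(stmt-RiemannHypothesis-11195; skeleton
`Summit.RiemannHypothesis.RiemannHypothesis.Cruxes.WindowTraceArch.DefectCompactnessDesign`).

**Statement.** Let `θ = riemannSiegelTheta` and let
`FL = {t : ℝ | 7 ≤ |t| ∧ cos θ(t) = 0}` be the symmetric França–LeClair half-lattice (its positive
points are the increasing-branch solutions of `θ(x) ∈ π/2 + πℤ`, `x ≥ 7`). Then `FL` is injectively
enumerated by `ℕ` (`x : ℕ → ℝ` injective with `Set.range x = FL`) and has a polynomial local count
profile: there are `C` and `N` with `#s ≤ C (1 + |T|)^N` for every finset `s` of indices whose points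
lie in `[T - 1, T + 1]`.

**Proof sketch.** `θ` is continuous (`continuous_riemannSiegelTheta`), odd
(`riemannSiegelTheta_neg_holds`), strictly increasing on `[7, ∞)`
(`strictMonoOn_riemannSiegelTheta_Ici_seven`) and tends to `+∞` (`tendsto_riemannSiegelTheta_atTop`).
* The positive half `FL₊ = {t | 7 ≤ t ∧ cos θ t = 0}` is countable: `θ` is injective on it and maps
  it into the countable set `π/2 + πℤ` (`Real.cos_eq_zero_iff`). It is infinite: every level
  `(2k+1)π/2 ≥ θ(7)` is attained on `[7, ∞)` by the intermediate value theorem, at distinct points for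
  distinct `k`. By parity `t ∈ FL ↔ |t| ∈ FL₊`, so `FL ⊆ FL₊ ∪ (-·)⁻¹' FL₊` is countable and (as
  `FL₊ ⊆ FL`) infinite, hence denumerable (`Set.countable_infinite_iff_nonempty_denumerable`); the
  enumeration is the inverse of `Denumerable.eqv`.
* Count profile: a finite set of points `u ∈ [7, R]` with `cos θ u = 0` is labelled injectively
  (strict monotonicity) by the integers `k` with `θ u = (2k+1)π/2`, which lie in
  `[θ(7)/π - 1/2, θ(R)/π - 1/2]`; so it has at most `(θ R - θ 7)/π + 1` elements, and
  `θ R ≤ (1 + R)² + |C₁|` by the explicit first-order Stirling bound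
  `abs_riemannSiegelTheta_sub_stirlingMain_le` (`log y ≤ y - 1`). Splitting the indices of `s` by the
  sign of `x n` and using `|x n| ≤ 1 + |T|` gives `#s ≤ 8 K (1 + |T|)²` with
  `K = 2 + |C₁| + |θ 7|`, i.e. the profile with `N = 2` (any polynomial profile is what the consumers
  `stub_domination` / `stub_compactness` / `stub_extensionOfDense` need).

**Sources.** G. França, A. LeClair, *Transcendental equations satisfied by the individual zeros of
Riemann ζ, Dirichlet and modular L-functions*, Commun. Number Theory Phys. 9 (2015), eq. (18)
(arXiv:1502.06003); H. M. Edwards, *Riemann's Zeta Function* (1974), §6.5 (Gram points,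
monotonicity of `ϑ`); E. C. Titchmarsh, *The Theory of the Riemann Zeta-Function* (1986), §4.17.
All ingredients are proved tree facts; the arguments here are elementary. [folklore]
-/

set_option linter.dupNamespace false

noncomputable section

open Set Filter
open scoped Real Topology

namespace Summit.RiemannHypothesis.RiemannHypothesis.Theorems.SpectralTraceWindowTraceArch

open Literature.NumberTheory.LFunctions
open Literature.Barriers.RiemannHypothesis

/-! ## Elementary facts about `θ` -/

/-- `θ` is monotone on `[7, ∞)` (`strictMonoOn_riemannSiegelTheta_Ici_seven`). [folklore] -/
theorem stub_base_monotoneOn : MonotoneOn riemannSiegelTheta (Ici 7) :=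
  strictMonoOn_riemannSiegelTheta_Ici_seven.monotoneOn

/-- `cos θ(-t) = cos θ(t)`, since `θ` is odd and `cos` is even. [folklore] -/
theorem stub_base_cos_neg (t : ℝ) :
    Real.cos (riemannSiegelTheta (-t)) = Real.cos (riemannSiegelTheta t) := by
  rw [riemannSiegelTheta_neg_holds t, Real.cos_neg]

/-- Every level `L ≥ θ(7)` is attained by `θ` on `[7, ∞)` (intermediate value theorem and
`θ → ∞`). [folklore] -/
theorem stub_base_exists_eq {L : ℝ} (hL : riemannSiegelTheta 7 ≤ L) :
    ∃ t : ℝ, 7 ≤ t ∧ riemannSiegelTheta t = L := by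
  obtain ⟨T, hT⟩ := (tendsto_atTop_atTop.1 tendsto_riemannSiegelTheta_atTop) L
  have h7T : (7 : ℝ) ≤ max T 7 := le_max_right _ _
  have hcont : ContinuousOn riemannSiegelTheta (Icc 7 (max T 7)) :=
    continuous_riemannSiegelTheta.continuousOn
  have hmem : L ∈ Icc (riemannSiegelTheta 7) (riemannSiegelTheta (max T 7)) :=
    ⟨hL, hT _ (le_max_left _ _)⟩
  obtain ⟨t, ht, hθt⟩ := intermediate_value_Icc h7T hcont hmem
  exact ⟨t, ht.1, hθt⟩

/-! ## The positive half-lattice `FL₊ = {t | 7 ≤ t ∧ cos θ t = 0}` is countably infinite -/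

/-- `FL₊` is countable: `θ` is injective on it (strictly increasing on `[7, ∞)`) with values in
the countable set `π/2 + πℤ`. [folklore] -/
theorem stub_base_countable :
    {t : ℝ | 7 ≤ t ∧ Real.cos (riemannSiegelTheta t) = 0}.Countable := by
  refine Set.MapsTo.countable_of_injOn (f := riemannSiegelTheta)
    (t := Set.range fun k : ℤ => (2 * (k : ℝ) + 1) * π / 2) ?_ ?_ (Set.countable_range _)
  · rintro t ⟨-, ht⟩
    obtain ⟨k, hk⟩ := Real.cos_eq_zero_iff.1 ht
    exact ⟨k, hk.symm⟩
  · exact strictMonoOn_riemannSiegelTheta_Ici_seven.injOn.mono fun t ht => ht.1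

/-- `FL₊` is infinite: the levels `(2(k₀ + n) + 1)π/2 ≥ θ(7)`, `n : ℕ`, are attained at pairwise
distinct points of `[7, ∞)`. [folklore] -/
theorem stub_base_infinite :
    {t : ℝ | 7 ≤ t ∧ Real.cos (riemannSiegelTheta t) = 0}.Infinite := by
  have hπ := Real.pi_pos
  obtain ⟨k₀, hk₀⟩ := exists_int_gt (riemannSiegelTheta 7 / π)
  have hk₀' : riemannSiegelTheta 7 < k₀ * π := by rwa [div_lt_iff₀ hπ] at hk₀
  have hlev : ∀ n : ℕ, riemannSiegelTheta 7 ≤ (2 * ((k₀ + n : ℤ) : ℝ) + 1) * π / 2 := by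
    intro n
    have hn : (0 : ℝ) ≤ n := n.cast_nonneg
    push_cast
    nlinarith
  choose f hf7 hfθ using fun n : ℕ => stub_base_exists_eq (hlev n)
  refine Set.infinite_of_injective_forall_mem (f := f) ?_ ?_
  · intro m n hmn
    have h := hfθ m
    rw [hmn, hfθ n] at h
    have h3 : ((k₀ + n : ℤ) : ℝ) * π = ((k₀ + m : ℤ) : ℝ) * π := by linarith
    have h4 := mul_right_cancel₀ hπ.ne' h3
    have h5 : (k₀ + n : ℤ) = k₀ + m := by exact_mod_cast h4
    omega
  · intro n
    exact ⟨hf7 n, Real.cos_eq_zero_iff.2 ⟨k₀ + n, hfθ n⟩⟩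

/-! ## The symmetric lattice `FL` is countably infinite, hence enumerated by `ℕ` -/

/-- `FL` is countable: `FL ⊆ FL₊ ∪ (-·)⁻¹' FL₊` by parity of `cos ∘ θ`. [folklore] -/
theorem stub_base_countable' :
    {t : ℝ | 7 ≤ |t| ∧ Real.cos (riemannSiegelTheta t) = 0}.Countable := by
  refine (stub_base_countable.union (stub_base_countable.preimage neg_injective)).mono ?_
  rintro t ⟨ht7, hcos⟩
  rcases le_total 0 t with ht | ht
  · exact Or.inl ⟨by rwa [abs_of_nonneg ht] at ht7, hcos⟩
  · refine Or.inr ⟨by rwa [abs_of_nonpos ht] at ht7, ?_⟩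
    show Real.cos (riemannSiegelTheta (-t)) = 0
    rwa [stub_base_cos_neg]

/-- `FL` is infinite: it contains `FL₊`. [folklore] -/
theorem stub_base_infinite' :
    {t : ℝ | 7 ≤ |t| ∧ Real.cos (riemannSiegelTheta t) = 0}.Infinite :=
  stub_base_infinite.mono fun t ht =>
    ⟨by rw [abs_of_nonneg (by linarith [ht.1])]; exact ht.1, ht.2⟩

/-- **Enumeration of `FL`.** There is an injective `x : ℕ → ℝ` with `Set.range x = FL`
(a countably infinite set is denumerable). [folklore] -/
theorem stub_base_enum :
    ∃ x : ℕ → ℝ, Function.Injective x ∧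
      Set.range x = {t : ℝ | 7 ≤ |t| ∧ Real.cos (riemannSiegelTheta t) = 0} := by
  obtain ⟨hden⟩ := Set.countable_infinite_iff_nonempty_denumerable.1
    ⟨stub_base_countable', stub_base_infinite'⟩
  set FL : Set ℝ := {t : ℝ | 7 ≤ |t| ∧ Real.cos (riemannSiegelTheta t) = 0} with hFL
  letI : Denumerable FL := hden
  set e : ℕ ≃ FL := (Denumerable.eqv FL).symm with he
  refine ⟨fun n => (e n : ℝ), Subtype.val_injective.comp e.injective, ?_⟩
  ext t
  constructor
  · rintro ⟨n, rfl⟩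
    exact (e n).2
  · intro ht
    exact ⟨e.symm ⟨t, ht⟩, by simp⟩

/-! ## The local count profile -/

/-- **Counting by integer labels.** A nonempty finite set of points `u ∈ [7, R]` with
`cos θ u = 0` has at most `(θ R - θ 7)/π + 1` elements: `u ↦ k`, `θ u = (2k+1)π/2`, is injective
(strict monotonicity of `θ`) with values in the integer interval
`[⌈θ 7/π - 1/2⌉, ⌊θ R/π - 1/2⌋]`. [folklore] -/
theorem stub_base_card_le_theta {R : ℝ} (F : Finset ℝ)
    (hF : ∀ u ∈ F, 7 ≤ u ∧ u ≤ R ∧ Real.cos (riemannSiegelTheta u) = 0) (hne : F.Nonempty) :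
    (F.card : ℝ) ≤ (riemannSiegelTheta R - riemannSiegelTheta 7) / π + 1 := by
  classical
  have hπ := Real.pi_pos
  have hlab : ∀ u ∈ F, ∃ k : ℤ, riemannSiegelTheta u = (2 * k + 1) * π / 2 := fun u hu =>
    Real.cos_eq_zero_iff.1 (hF u hu).2.2
  let lab : ℝ → ℤ := fun u => if hu : u ∈ F then (hlab u hu).choose else 0
  have hlab_spec : ∀ u ∈ F, riemannSiegelTheta u = (2 * (lab u : ℝ) + 1) * π / 2 := by
    intro u hu
    simp only [lab, dif_pos hu]
    exact (hlab u hu).choose_spec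
  set a : ℤ := ⌈riemannSiegelTheta 7 / π - 1 / 2⌉ with ha
  set b : ℤ := ⌊riemannSiegelTheta R / π - 1 / 2⌋ with hb
  have hbounds : ∀ u ∈ F, riemannSiegelTheta 7 ≤ riemannSiegelTheta u ∧
      riemannSiegelTheta u ≤ riemannSiegelTheta R := by
    intro u hu
    obtain ⟨h7, hR, -⟩ := hF u hu
    exact ⟨stub_base_monotoneOn (le_refl (7 : ℝ)) h7 h7,
      stub_base_monotoneOn h7 (h7.trans hR) hR⟩
  have hmaps : Set.MapsTo lab (F : Set ℝ) (Finset.Icc a b : Finset ℤ) := by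
    intro u hu
    rw [Finset.mem_coe] at hu
    obtain ⟨h1, h2⟩ := hbounds u hu
    have hs := hlab_spec u hu
    rw [Finset.coe_Icc]
    constructor
    · rw [ha, Int.ceil_le, sub_le_iff_le_add, div_le_iff₀ hπ]
      linarith
    · rw [hb, Int.le_floor, le_sub_iff_add_le, le_div_iff₀ hπ]
      linarith
  have hinj : Set.InjOn lab (F : Set ℝ) := by
    intro u hu v hv huv
    rw [Finset.mem_coe] at hu hv
    have hθ : riemannSiegelTheta u = riemannSiegelTheta v := by
      rw [hlab_spec u hu, hlab_spec v hv, huv]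
    exact strictMonoOn_riemannSiegelTheta_Ici_seven.injOn (hF u hu).1 (hF v hv).1 hθ
  have hcard := Finset.card_le_card_of_injOn lab hmaps hinj
  rw [Int.card_Icc] at hcard
  obtain ⟨u₀, hu₀⟩ := hne
  have hu₀' := hmaps (Finset.mem_coe.2 hu₀)
  rw [Finset.coe_Icc] at hu₀'
  have h0 : 0 ≤ b + 1 - a := by linarith [hu₀'.1, hu₀'.2]
  have hcast : (((b + 1 - a).toNat : ℕ) : ℝ) = (b : ℝ) + 1 - a := by
    have h := Int.toNat_of_nonneg h0
    rw [← Int.cast_natCast, h]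
    push_cast
    ring
  have hb' : (b : ℝ) ≤ riemannSiegelTheta R / π - 1 / 2 := Int.floor_le _
  have ha' : riemannSiegelTheta 7 / π - 1 / 2 ≤ a := Int.le_ceil _
  calc (F.card : ℝ) ≤ (((b + 1 - a).toNat : ℕ) : ℝ) := by exact_mod_cast hcard
    _ = b + 1 - a := hcast
    _ ≤ (riemannSiegelTheta R - riemannSiegelTheta 7) / π + 1 := by rw [sub_div]; linarith

/-- **Polynomial growth of `θ`**: `θ(R) ≤ (1 + R)² + |C₁|` for `R ≥ 1`, with
`C₁ = θ(1) - (½ log(1/2π) - ½)`, from the explicit first-order Stirling bound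
`abs_riemannSiegelTheta_sub_stirlingMain_le` and `log y ≤ y - 1`. [folklore] -/
theorem stub_base_theta_le {R : ℝ} (hR : 1 ≤ R) :
    riemannSiegelTheta R ≤ (1 + R) ^ 2 +
      |riemannSiegelTheta 1 - (1 / 2 * Real.log (1 / (2 * π)) - 1 / 2)| := by
  have h := (abs_le.1 (abs_riemannSiegelTheta_sub_stirlingMain_le hR)).2
  have hR0 : 0 < R := by linarith
  have hπ : 0 < 2 * π := by positivity
  have hlog1 : Real.log (R / (2 * π)) ≤ R / (2 * π) - 1 :=
    Real.log_le_sub_one_of_pos (by positivity)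
  have hlog2 : Real.log R ≤ R - 1 := Real.log_le_sub_one_of_pos hR0
  have hq : R / (2 * π) ≤ R := by
    rw [div_le_iff₀ hπ]
    nlinarith [Real.pi_gt_three]
  have h1 : R / 2 * Real.log (R / (2 * π)) ≤ R / 2 * (R - 1) :=
    mul_le_mul_of_nonneg_left (by linarith) (by linarith)
  have hC := le_abs_self (riemannSiegelTheta 1 - (1 / 2 * Real.log (1 / (2 * π)) - 1 / 2))
  nlinarith

/-- **Log-sparsity, polynomial form.** A finite set of points `u ∈ [7, R]` (`R ≥ 0`) with
`cos θ u = 0` has at most `K (1 + R)²` elements, `K = 2 + |C₁| + |θ 7|`. [folklore] -/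
theorem stub_base_card_le {R : ℝ} (hR : 0 ≤ R) (F : Finset ℝ)
    (hF : ∀ u ∈ F, 7 ≤ u ∧ u ≤ R ∧ Real.cos (riemannSiegelTheta u) = 0) :
    (F.card : ℝ) ≤ (2 + |riemannSiegelTheta 1 - (1 / 2 * Real.log (1 / (2 * π)) - 1 / 2)| +
      |riemannSiegelTheta 7|) * (1 + R) ^ 2 := by
  rcases F.eq_empty_or_nonempty with hF0 | hne
  · rw [hF0, Finset.card_empty, Nat.cast_zero]
    positivity
  · obtain ⟨u₀, hu₀⟩ := hne
    have hR7 : 7 ≤ R := (hF u₀ hu₀).1.trans (hF u₀ hu₀).2.1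
    have h1 := stub_base_card_le_theta F hF ⟨u₀, hu₀⟩
    have h2 := stub_base_theta_le (show (1 : ℝ) ≤ R by linarith)
    have h3 : -riemannSiegelTheta 7 ≤ |riemannSiegelTheta 7| := neg_le_abs _
    have hπ3 := Real.pi_gt_three
    have hsq : 1 ≤ (1 + R) ^ 2 := by nlinarith
    have hC0 := abs_nonneg (riemannSiegelTheta 1 - (1 / 2 * Real.log (1 / (2 * π)) - 1 / 2))
    have h70 := abs_nonneg (riemannSiegelTheta 7)
    have h4 : (riemannSiegelTheta R - riemannSiegelTheta 7) / π ≤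
        (1 + R) ^ 2 + |riemannSiegelTheta 1 - (1 / 2 * Real.log (1 / (2 * π)) - 1 / 2)| +
          |riemannSiegelTheta 7| := by
      rw [div_le_iff₀ Real.pi_pos]
      nlinarith
    nlinarith

/-! ## The registered stub -/

/-- **stub_base — the França–LeClair base configuration.** The symmetric Gram-type half
lattice `FL = {t : 7 ≤ |t| ∧ cos θ(t) = 0}` (`θ = riemannSiegelTheta`; positive points: the
increasing-branch solutions of `θ(xₙ) = (n - 3/2)π`, França–LeClair arXiv:1502.06003 eq. (18) with
`arg ζ` dropped; the cut `|t| ≥ 7` removes the decreasing-branch pair) is countably infinite —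
enumerated injectively by `ℕ` — and LOG-SPARSE: at most `C (1 + |T|)^N` of its points lie in any
unit cell `[T - 1, T + 1]` (here with `N = 2`; in truth `O(1 + log(1 + |T|))`). Proof: `θ` is
continuous, odd, strictly increasing on `[7, ∞)` and unbounded, so `FL ∩ [7, ∞)` is
`θ⁻¹(π/2 + πℤ) ∩ [7, ∞)`, countable (one point per level) and infinite (IVT), hence `FL ≃ ℕ`; the
count is by injective integer labels `k`, `θ(u) = (2k+1)π/2`, and the Stirling bound
`θ(R) ≤ (1 + R)² + O(1)`. [folklore] -/
theorem stub_base :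
    ∃ x : ℕ → ℝ, Function.Injective x ∧
      Set.range x = {t : ℝ | 7 ≤ |t| ∧ Real.cos (Literature.NumberTheory.LFunctions.riemannSiegelTheta t) = 0} ∧
      ∃ (C : ℝ) (N : ℕ), ∀ (T : ℝ) (s : Finset ℕ), (∀ n ∈ s, |x n - T| ≤ 1) →
        (s.card : ℝ) ≤ C * (1 + |T|) ^ N := by
  classical
  obtain ⟨x, hxinj, hxrange⟩ := stub_base_enum
  set K : ℝ := 2 + |riemannSiegelTheta 1 - (1 / 2 * Real.log (1 / (2 * π)) - 1 / 2)| +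
      |riemannSiegelTheta 7| with hK
  refine ⟨x, hxinj, hxrange, 8 * K, 2, fun T s hs => ?_⟩
  have hmem : ∀ n, 7 ≤ |x n| ∧ Real.cos (riemannSiegelTheta (x n)) = 0 := by
    intro n
    have h := Set.mem_range_self (f := x) n
    rw [hxrange] at h
    exact h
  have hR : (0 : ℝ) ≤ 1 + |T| := by positivity
  have hT1 := le_abs_self T
  have hT2 := neg_abs_le T
  -- indices with a nonnegative point
  have hp : ((s.filter fun n => 0 ≤ x n).card : ℝ) ≤ K * (1 + (1 + |T|)) ^ 2 := by
    have hc : ((s.filter fun n => 0 ≤ x n).image x).card = (s.filter fun n => 0 ≤ x n).card :=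
      Finset.card_image_of_injective _ hxinj
    have h := stub_base_card_le hR ((s.filter fun n => 0 ≤ x n).image x) ?_
    · rw [hc] at h
      exact h
    intro u hu
    obtain ⟨n, hn, rfl⟩ := Finset.mem_image.1 hu
    obtain ⟨hns, hn0⟩ := Finset.mem_filter.1 hn
    obtain ⟨h7, hcos⟩ := hmem n
    have hT := abs_le.1 (hs n hns)
    rw [abs_of_nonneg hn0] at h7
    exact ⟨h7, by linarith [hT.2], hcos⟩
  -- indices with a negative point
  have hm : ((s.filter fun n => ¬ 0 ≤ x n).card : ℝ) ≤ K * (1 + (1 + |T|)) ^ 2 := by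
    have hinj' : Function.Injective (fun n => -x n) := fun a b h => hxinj (neg_injective h)
    have hc : ((s.filter fun n => ¬ 0 ≤ x n).image fun n => -x n).card =
        (s.filter fun n => ¬ 0 ≤ x n).card :=
      Finset.card_image_of_injective _ hinj'
    have h := stub_base_card_le hR ((s.filter fun n => ¬ 0 ≤ x n).image fun n => -x n) ?_
    · rw [hc] at h
      exact h
    intro u hu
    obtain ⟨n, hn, rfl⟩ := Finset.mem_image.1 hu
    obtain ⟨hns, hn0⟩ := Finset.mem_filter.1 hn
    rw [not_le] at hn0
    obtain ⟨h7, hcos⟩ := hmem n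
    have hT := abs_le.1 (hs n hns)
    rw [abs_of_neg hn0] at h7
    exact ⟨h7, by linarith [hT.1], by rwa [stub_base_cos_neg]⟩
  have hsplit := Finset.card_filter_add_card_filter_not (s := s) (fun n => 0 ≤ x n)
  have hK0 : 0 ≤ K := by positivity
  have hsq : (1 + (1 + |T|)) ^ 2 ≤ 4 * (1 + |T|) ^ 2 := by nlinarith [abs_nonneg T]
  calc (s.card : ℝ)
        = ((s.filter fun n => 0 ≤ x n).card : ℝ) + ((s.filter fun n => ¬ 0 ≤ x n).card : ℝ) := by
          rw [← hsplit]
          push_cast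
          ring
    _ ≤ 2 * (K * (1 + (1 + |T|)) ^ 2) := by linarith
    _ ≤ 8 * K * (1 + |T|) ^ 2 := by nlinarith

end Summit.RiemannHypothesis.RiemannHypothesis.Theorems.SpectralTraceWindowTraceArch

end
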